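import Literature.NumberTheory.GaloisRepresentations.LabelledWeightsDeRhamRank
import Literature.NumberTheory.GaloisRepresentations.LabelledWeightsTateTwist
import HarnessLib

/-!
# `HT_τ(1) = {0, …, 0}` for every period ring and `HT_τ(ε^m) = {-m}` for Fontaine's `B_dR`:
# clause (F11) of THE pinned datum, unconditionally

Topic `Literature/NumberTheory/PAdicHodge`; theorems only (no definition, no named fact).  Companion of
the accepted `FontaineDpst` (clause (F11) `IsFontaineDatum.cyclotomicPowersLabelledWeights` of the
specification of the pin, hitherto derived for THE datum only from the named fact
`FontaineDatumExists`: `fontainePst_cyclotomicPowersLabelledWeights`,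
`cyclotomicPowersLabelledWeights_fontainePstAdicCompletion`,
`FontaineDatumExists.pinnedCyclotomicPowersWeights`), of
`GaloisRepresentations/PstWeilDeligneCyclotomicPowersWeights` (the predicate
`PstWeilDeligneData.CyclotomicPowersLabelledWeights`), `LabelledWeightsTateTwist` (Tate twists shift
`HT_τ` by `-m` for `B_dR`, unconditionally for the pin) and `LabelledWeightsDeRhamRank`
(`dim_{ℚ̄_p} D_τ(ρ) = n` for de Rham `ρ`, separation of `M ⊗ Fil^• B` by coordinates).

## Mathematics

1. **The trivial representation, for ANY period-ring datum** `𝔅 = (B, Γ ↷, F = B^Γ, Fil^•)` over the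
   prime field `P` and any coefficient field `E ⊇ P`: if `Γ` acts trivially on `M`, then in a `P`-basis
   of `M` the diagonal action on `M ⊗_P B ≅ ⊕ B` is coordinatewise, so the invariants `D(ρ)` have all
   coordinates in `B^Γ = F · 1`; since `F · 1 ⊆ Fil⁰ B` and `F · 1 ∩ Fil¹ B = 0` (a nonzero scalar is a
   unit of `Fil⁰`, and `1 ∈ Fil¹` would force `1 ∈ ⋂_i Fil^i = 0`), `Fil^i D_τ = D_τ` for `i ≤ 0` and
   `Fil^i D_τ = 0` for `i ≥ 1`: **`HT_τ(ρ) = {0, …, 0}`** with multiplicity `dim_E D_τ(ρ)`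
   (`PeriodRingData.labelledHodgeTateWeights_of_forall_eq`; Fontaine 1994, Exp. III §1.5: `D_B(P) = F`).
2. **For THE pinned datum `fontainePst F p hp`** (period ring `B_dR(F)`, a field): the trivial rank-`n`
   representation is de Rham (it is unramified), so `dim_{ℚ̄_p} D_τ(1) = n` (accepted
   `fontainePst_finiteDimensional_labelD_and_finrank_eq`) and `HT_τ(1) = {0}^n`; by the accepted shift
   under Tate twists (`fontainePst_labelledHodgeTateWeights_of_cyclotomic_zpow`: `HT_τ(ρ ⊗ χ^m) =
   HT_τ(ρ) - m`) every rank-one framed `χ` with entries `ε_F(σ)^m` has **`HT_τ(χ) = {-m}`** at every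
   `ℚ_p`-embedding `τ : F → ℚ̄_p` — i.e. clause (F11) `CyclotomicPowersLabelledWeights` holds for THE
   datum UNCONDITIONALLY (`cyclotomicPowersLabelledWeights_fontainePst_of_bdR`), and so does the
   statement of the route child `PinnedCyclotomicPowersWeights` of `Langlands/WachComponentCensus`
   (`pinnedCyclotomicPowersWeights_of_bdR`, VERBATIM the conclusion of the accepted
   `FontaineDatumExists.pinnedCyclotomicPowersWeights`, without the hypothesis).  This is Fontaine's
   computation `D_dR(ℚ_p(m)) = F · t^{-m}`, `Fil^i B_dR = t^i B_dR⁺` (Exp. II §1.5.5, Exp. III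
   §1.5.4–1.5.5), in the sign convention `HT_τ(ε) = {-1}` of Barnet-Lamb–Gee–Geraghty–Taylor.

## Main results

* `PeriodRingData.restrictScalars_one_le_fil_zero`, `PeriodRingData.restrictScalars_one_inf_fil_eq_bot`,
  `PeriodRingData.coeffD_le_range_of_forall_eq`, `PeriodRingData.labelFilD_eq_labelD_of_forall_eq`,
  `PeriodRingData.labelFilD_eq_bot_of_forall_eq`, `PeriodRingData.labelledHodgeTateWeights_of_forall_eq` — 1.
* `Literature.NumberTheory.PAdicHodge.fontainePst_labelledHodgeTateWeights_one`,
  `….cyclotomicPowersLabelledWeights_fontainePst_of_bdR`,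
  `….cyclotomicPowersLabelledWeights_fontainePstAdicCompletion_of_bdR`,
  `….pinnedCyclotomicPowersWeights_of_bdR` — 2.

## References

* J.-M. Fontaine, *Le corps des périodes p-adiques* (Exp. II §1.5.5) and *Représentations p-adiques
  semi-stables* (Exp. III §1.5), Astérisque 223 (1994). [FontaineAsterisque223III]
* T. Barnet-Lamb, T. Gee, D. Geraghty, R. Taylor, Ann. of Math. 179 (2014), Introduction, Notation
  (`HT_τ(ε_l) = {-1}`). [BarnetlambEtAl2014]
* K. Buzzard, T. Gee, *The conjectural connections …* (2014), §2.4. [BuzzardGeeLMS2014]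
* S. Patrikis, *Variations on a theorem of Tate*, Mem. AMS 258 (2019), §2.7.1. [Patrikis2019]
-/

noncomputable section

open scoped TensorProduct NumberField MatrixGroups
open TensorProduct Module Field

namespace Literature.NumberTheory.GaloisRepresentations

namespace PeriodRingData

universe u v v' w

-- Mathlib's own global value of `maxSynthPendingDepth` (see `LabelledWeightsTwist`); the large
-- tensor types also need a higher instance-synthesis budget.
set_option maxSynthPendingDepth 3
set_option synthInstance.maxHeartbeats 200000

/-! ### `F · 1 ⊆ Fil⁰` and `F · 1 ∩ Fil¹ = 0` -/

section Scalars

variable {Γ : Type u} [Group Γ] {P : Type v} {F : Type v'} [Field P] [Field F] [Algebra P F]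
  (𝔅 : PeriodRingData.{u, v, v', w} Γ P F)

/-- **`F · 1 ⊆ Fil⁰ B`** (`1 ∈ Fil⁰` and `Fil⁰` is an `F`-submodule). [folklore] -/
theorem restrictScalars_one_le_fil_zero :
    (1 : Submodule F 𝔅.B).restrictScalars P ≤ (𝔅.fil 0).restrictScalars P := by
  intro b hb
  obtain ⟨f, rfl⟩ := Submodule.mem_one.1 hb
  change algebraMap F 𝔅.B f ∈ 𝔅.fil 0
  rw [Algebra.algebraMap_eq_smul_one]
  exact (𝔅.fil 0).smul_mem f 𝔅.one_mem_fil_zero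

/-- **`F · 1 ∩ Fil¹ B = 0`**: a nonzero scalar `f · 1 ∈ Fil¹` would give `1 = f⁻¹ · (f · 1) ∈ Fil¹`,
hence `1 = 1 · 1 ∈ Fil²`, …, `1 ∈ ⋂_i Fil^i B = 0`, absurd in the domain `B` (the statement
`1 ∉ Fil¹ B` is the prover-side `LiftB2CrysSplitP.periodRing_one_not_mem_fil_one` of
`Summits/Langlands`, re-derived inline here since Literature does not import Summits).
[cite: FontaineAsterisque223III, Exp. III §1.5] -/
theorem restrictScalars_one_inf_fil_eq_bot :
    (1 : Submodule F 𝔅.B).restrictScalars P ⊓ (𝔅.fil 1).restrictScalars P = ⊥ := by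
  -- `1 ∉ Fil¹ B`
  have hone : (1 : 𝔅.B) ∉ 𝔅.fil 1 := by
    intro h1
    have hpos : ∀ k : ℕ, (1 : 𝔅.B) ∈ 𝔅.fil (k + 1 : ℕ) := by
      intro k
      induction k with
      | zero => simpa using h1
      | succ k ih =>
        have h := 𝔅.mul_mem_fil _ _ _ _ ih h1
        rw [mul_one] at h
        have hk : ((k + 1 : ℕ) : ℤ) + 1 = ((k + 1 + 1 : ℕ) : ℤ) := by push_cast; ring
        rwa [hk] at h
    have hall : ∀ i : ℤ, (1 : 𝔅.B) ∈ 𝔅.fil i := by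
      intro i
      by_cases hi : i ≤ 1
      · exact 𝔅.fil_antitone hi h1
      · obtain ⟨k, hk⟩ := Int.eq_ofNat_of_zero_le (show (0 : ℤ) ≤ i - 1 by omega)
        have hi' : i = ((k + 1 : ℕ) : ℤ) := by push_cast; omega
        rw [hi']
        exact hpos k
    have hmem : (1 : 𝔅.B) ∈ ⨅ i, 𝔅.fil i := (Submodule.mem_iInf _).2 hall
    rw [𝔅.iInf_fil, Submodule.mem_bot] at hmem
    exact one_ne_zero hmem
  refine (Submodule.eq_bot_iff _).2 fun b hb => ?_
  obtain ⟨hb1, hb2⟩ := Submodule.mem_inf.1 hb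
  obtain ⟨f, rfl⟩ := Submodule.mem_one.1 hb1
  change algebraMap F 𝔅.B f ∈ 𝔅.fil 1 at hb2
  by_contra hf0
  have hf : f ≠ 0 := fun h => hf0 (by rw [h, map_zero])
  have h1 : (1 : 𝔅.B) ∈ 𝔅.fil 1 := by
    have h := (𝔅.fil 1).smul_mem f⁻¹ hb2
    rwa [Algebra.smul_def, ← map_mul, inv_mul_cancel₀ hf, map_one] at h
  exact hone h1

end Scalars

/-! ### Coordinates of `M ⊗_P B` and the invariants of a trivial action -/

section Coords

variable {Γ : Type u} [Group Γ] [TopologicalSpace Γ] {P : Type v} {F : Type v'} [Field P]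
  [Field F] [Algebra P F]
  {E : Type*} [Field E] [Algebra P E] [TopologicalSpace E]
  {M : Type*} [AddCommGroup M] [Module E M] [Module P M] [IsScalarTower P E M]
  [TopologicalSpace M]
  (𝔅 : PeriodRingData.{u, v, v', w} Γ P F)

omit [TopologicalSpace Γ] [TopologicalSpace E] [TopologicalSpace M] in
open scoped Classical in
/-- Coordinates of a pure tensor. [folklore] -/
private theorem coords_tmul (m : M) (b : 𝔅.B) (k : Basis.ofVectorSpaceIndex P M) :
    (TensorProduct.congr (Basis.ofVectorSpace P M).repr (LinearEquiv.refl P 𝔅.B) ≪≫ₗ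
      finsuppScalarLeft P 𝔅.B (Basis.ofVectorSpaceIndex P M)) (m ⊗ₜ[P] b) k =
      (Basis.ofVectorSpace P M).repr m k • b := by
  simp only [LinearEquiv.trans_apply, TensorProduct.congr_tmul, LinearEquiv.refl_apply,
    finsuppScalarLeft_apply_tmul_apply]

omit [TopologicalSpace Γ] [TopologicalSpace E] [TopologicalSpace M] in
open scoped Classical in
/-- The inverse coordinate map on a single coordinate. [folklore] -/
private theorem coords_symm_single (k : Basis.ofVectorSpaceIndex P M) (b : 𝔅.B) :
    (TensorProduct.congr (Basis.ofVectorSpace P M).repr (LinearEquiv.refl P 𝔅.B) ≪≫ₗ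
      finsuppScalarLeft P 𝔅.B (Basis.ofVectorSpaceIndex P M)).symm (Finsupp.single k b) =
      (Basis.ofVectorSpace P M k) ⊗ₜ[P] b := by
  rw [LinearEquiv.trans_symm, LinearEquiv.trans_apply, finsuppScalarLeft_symm_apply_single,
    TensorProduct.congr_symm_tmul, LinearEquiv.refl_symm, LinearEquiv.refl_apply,
    Basis.repr_symm_single_one]

omit [TopologicalSpace Γ] [TopologicalSpace E] [TopologicalSpace M] in
open scoped Classical in
/-- **A tensor all of whose coordinates lie in the `P`-subspace `N ⊆ B` lies in `M ⊗ N`.** [folklore] -/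
private theorem mem_range_of_coords_mem (N : Submodule P 𝔅.B) (x : M ⊗[P] 𝔅.B)
    (h : ∀ k, (TensorProduct.congr (Basis.ofVectorSpace P M).repr (LinearEquiv.refl P 𝔅.B) ≪≫ₗ
      finsuppScalarLeft P 𝔅.B (Basis.ofVectorSpaceIndex P M)) x k ∈ N) :
    x ∈ LinearMap.range (AlgebraTensorModule.map (LinearMap.id : M →ₗ[E] M) N.subtype) := by
  set e := TensorProduct.congr (Basis.ofVectorSpace P M).repr (LinearEquiv.refl P 𝔅.B) ≪≫ₗ
    finsuppScalarLeft P 𝔅.B (Basis.ofVectorSpaceIndex P M) with he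
  have hx : x = e.symm (e x) := (e.symm_apply_apply x).symm
  rw [hx, ← Finsupp.sum_single (e x), Finsupp.sum, map_sum]
  refine Submodule.sum_mem _ fun k _ => ?_
  rw [he, coords_symm_single]
  exact ⟨(Basis.ofVectorSpace P M k) ⊗ₜ ⟨e x k, h k⟩, rfl⟩

variable (ρ : ContinuousRep Γ E M)

open scoped Classical in
/-- **A trivial action is coordinatewise**: if `Γ` acts trivially on `M`, the `k`-th coordinate of
`σ • x` (diagonal action on `M ⊗_P B`) is `σ` applied to the `k`-th coordinate of `x`. [folklore] -/
private theorem coords_coeffTensorRep_of_forall_eq (hρ : ∀ (σ : Γ) (v : M), ρ σ v = v) (σ : Γ)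
    (x : M ⊗[P] 𝔅.B) (k : Basis.ofVectorSpaceIndex P M) :
    (TensorProduct.congr (Basis.ofVectorSpace P M).repr (LinearEquiv.refl P 𝔅.B) ≪≫ₗ
      finsuppScalarLeft P 𝔅.B (Basis.ofVectorSpaceIndex P M)) (𝔅.coeffTensorRep ρ σ x) k =
      σ • (TensorProduct.congr (Basis.ofVectorSpace P M).repr (LinearEquiv.refl P 𝔅.B) ≪≫ₗ
        finsuppScalarLeft P 𝔅.B (Basis.ofVectorSpaceIndex P M)) x k := by
  induction x using TensorProduct.induction_on with
  | zero => rw [map_zero, LinearEquiv.map_zero, Finsupp.zero_apply, smul_zero]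
  | tmul m b =>
    rw [coeffTensorRep_apply_tmul, hρ, coords_tmul, coords_tmul]
    exact (smul_comm σ _ _).symm
  | add x y hx hy =>
    rw [map_add, map_add, Finsupp.add_apply, hx, hy, LinearEquiv.map_add, Finsupp.add_apply, smul_add]

/-- **The invariants of a trivial action lie in `M ⊗ F`**: if `Γ` acts trivially on `M`, then
`D(ρ) = (M ⊗_P B)^Γ ⊆ M ⊗ (F · 1)` (every coordinate of an invariant tensor is invariant, hence in
`B^Γ = F · 1`).  [cite: FontaineAsterisque223III, Exp. III §1.5] -/
theorem coeffD_le_range_of_forall_eq (hρ : ∀ (σ : Γ) (v : M), ρ σ v = v) :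
    𝔅.coeffD ρ ≤ LinearMap.range (AlgebraTensorModule.map (LinearMap.id : M →ₗ[E] M)
      ((1 : Submodule F 𝔅.B).restrictScalars P).subtype) := by
  classical
  intro x hx
  refine 𝔅.mem_range_of_coords_mem _ x fun k => ?_
  have hinv : ∀ σ : Γ, σ • (TensorProduct.congr (Basis.ofVectorSpace P M).repr
      (LinearEquiv.refl P 𝔅.B) ≪≫ₗ finsuppScalarLeft P 𝔅.B (Basis.ofVectorSpaceIndex P M)) x k =
      (TensorProduct.congr (Basis.ofVectorSpace P M).repr (LinearEquiv.refl P 𝔅.B) ≪≫ₗ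
        finsuppScalarLeft P 𝔅.B (Basis.ofVectorSpaceIndex P M)) x k := fun σ => by
    rw [← 𝔅.coords_coeffTensorRep_of_forall_eq ρ hρ σ x k, hx σ]
  have hmem : (TensorProduct.congr (Basis.ofVectorSpace P M).repr (LinearEquiv.refl P 𝔅.B) ≪≫ₗ
      finsuppScalarLeft P 𝔅.B (Basis.ofVectorSpaceIndex P M)) x k ∈
      {b : 𝔅.B | ∀ σ : Γ, σ • b = b} := hinv
  rw [𝔅.invariants_eq] at hmem
  obtain ⟨f, hf⟩ := hmem
  change _ ∈ (1 : Submodule F 𝔅.B)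
  exact Submodule.mem_one.2 ⟨f, hf⟩

variable (τ : F →+* E)

/-- **`Fil^i D_τ = D_τ` for `i ≤ 0` when `Γ` acts trivially on `M`** (`D ⊆ M ⊗ (F · 1) ⊆ M ⊗ Fil⁰`).
[cite: FontaineAsterisque223III, Exp. III §1.5] -/
theorem labelFilD_eq_labelD_of_forall_eq (hρ : ∀ (σ : Γ) (v : M), ρ σ v = v) {i : ℤ} (hi : i ≤ 0) :
    𝔅.labelFilD ρ τ i = 𝔅.labelD ρ τ := by
  rw [labelFilD]
  refine inf_eq_left.2 fun x hx => 𝔅.coeffFilTensor_antitone E M hi ?_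
  obtain ⟨y, hy⟩ := 𝔅.coeffD_le_range_of_forall_eq ρ hρ hx.1
  refine ⟨AlgebraTensorModule.map (LinearMap.id : M →ₗ[E] M)
    (Submodule.inclusion (𝔅.restrictScalars_one_le_fil_zero)) y, ?_⟩
  rw [← hy, ← LinearMap.comp_apply, ← AlgebraTensorModule.map_comp]
  rfl

/-- **`Fil^i D_τ = 0` for `i ≥ 1` when `Γ` acts trivially on `M`** (`D ⊆ M ⊗ (F · 1)`, and
`(M ⊗ (F · 1)) ∩ (M ⊗ Fil¹) = M ⊗ (F · 1 ∩ Fil¹) = 0`, accepted `range_map_subtype_inf_eq_bot`).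
[cite: FontaineAsterisque223III, Exp. III §1.5] -/
theorem labelFilD_eq_bot_of_forall_eq (hρ : ∀ (σ : Γ) (v : M), ρ σ v = v) {i : ℤ} (hi : 1 ≤ i) :
    𝔅.labelFilD ρ τ i = ⊥ := by
  refine eq_bot_iff.2 fun x hx => ?_
  rw [labelFilD] at hx
  have h := 𝔅.range_map_subtype_inf_eq_bot (M := M) (E := E) _ _ 𝔅.restrictScalars_one_inf_fil_eq_bot
  rw [← h]
  exact ⟨𝔅.coeffD_le_range_of_forall_eq ρ hρ hx.1.1, 𝔅.coeffFilTensor_antitone E M hi hx.2⟩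

/-- **All labelled Hodge–Tate weights of a representation with trivial `Γ`-action are `0`**, for
EVERY period-ring datum and every label: `HT_τ(ρ) = {0, …, 0}` with multiplicity `dim_E D_τ(ρ)`
(`D_B` of the trivial representation is `F ⊗_P E`-valued in `Fil⁰ ∖ Fil¹`).
[cite: FontaineAsterisque223III, Exp. III §1.5] [cite: Patrikis2019, §2.3.1] -/
theorem labelledHodgeTateWeights_of_forall_eq (hρ : ∀ (σ : Γ) (v : M), ρ σ v = v) :
    𝔅.labelledHodgeTateWeights ρ τ = Multiset.replicate (Module.finrank E (𝔅.labelD ρ τ)) 0 := by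
  rw [labelledHodgeTateWeights_def, ← jumpMultiset_step]
  congr 1
  funext i
  by_cases hi : i ≤ 0
  · rw [if_pos hi, 𝔅.labelFilD_eq_labelD_of_forall_eq ρ τ hρ hi]
  · rw [if_neg hi, 𝔅.labelFilD_eq_bot_of_forall_eq ρ τ hρ (by omega), finrank_bot]

end Coords

end PeriodRingData

end Literature.NumberTheory.GaloisRepresentations

/-! ### THE pinned datum: `HT_τ(1) = {0}^n`, `HT_τ(ε^m) = {-m}`, clause (F11) unconditionally -/

namespace Literature.NumberTheory.PAdicHodge

open ValuativeRel IsDedekindDomain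
open Literature.NumberTheory.GaloisRepresentations
open Literature.NumberTheory.GaloisRepresentations.IsNonarchimedeanLocalField

section Local

variable {F : Type} [Field F] [ValuativeRel F] [TopologicalSpace F] [IsNonarchimedeanLocalField F]
  [CharZero F] {p : ℕ} [Fact p.Prime]

omit [ValuativeRel F] [TopologicalSpace F] [IsNonarchimedeanLocalField F] [CharZero F] in
/-- The trivial framed representation acts trivially on `ℚ̄_pⁿ`. [folklore] -/
theorem toContinuousRep_one_apply {n : ℕ} (σ : absoluteGaloisGroup F) (v : Fin n → PadicAlgCl p) :
    FramedRep.toContinuousRep (1 : FramedRep (absoluteGaloisGroup F) (PadicAlgCl p) n) σ v = v := by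
  rw [FramedRep.toContinuousRep_apply_apply]
  change Matrix.mulVec ((1 : GL (Fin n) (PadicAlgCl p)) : Matrix (Fin n) (Fin n) (PadicAlgCl p)) v = v
  rw [Units.val_one, Matrix.one_mulVec]

/-- **`HT_τ(1) = {0, …, 0}` (`n` times) for THE pinned datum — unconditionally**: the trivial rank-`n`
representation is de Rham for `fontainePst F p hp` (it is unramified), so `dim_{ℚ̄_p} D_τ(1) = n`
(accepted `fontainePst_finiteDimensional_labelD_and_finrank_eq`), and all its labelled weights are `0`
(`labelledHodgeTateWeights_of_forall_eq`). [cite: FontaineAsterisque223III, Exp. III §1.5]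
[cite: Patrikis2019, §2.7.1] -/
theorem fontainePst_labelledHodgeTateWeights_one (hp : valuation F p < 1) {n : ℕ} :
    letI := (fontainePst F p hp).algebra
    ∀ τ : F →ₐ[ℚ_[p]] PadicAlgCl p,
      (fontainePst F p hp).𝔅.labelledHodgeTateWeights
        (FramedRep.toContinuousRep (1 : FramedRep (absoluteGaloisGroup F) (PadicAlgCl p) n))
        τ.toRingHom = Multiset.replicate n 0 := by
  letI := (fontainePst F p hp).algebra
  intro τ
  have hdR : (fontainePst F p hp).IsDeRhamFramed
      (1 : FramedRep (absoluteGaloisGroup F) (PadicAlgCl p) n) :=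
    (fontainePst F p hp).isDeRhamFramed_of_isLocallyUnramified FramedRep.isLocallyUnramified_one
  obtain ⟨-, hrank⟩ := fontainePst_finiteDimensional_labelD_and_finrank_eq hp hdR τ
  rw [(fontainePst F p hp).𝔅.labelledHodgeTateWeights_of_forall_eq _ τ.toRingHom
    toContinuousRep_one_apply, hrank]

/-- **Clause (F11) holds for THE pinned datum — unconditionally**: for every `m : ℤ`, every rank-one
framed `χ : Γ_F →ₜ* GL₁(ℚ̄_p)` with entries `ε_F(σ)^m` and every `ℚ_p`-embedding `τ : F → ℚ̄_p`,
`HT_τ(χ) = {-m}` relative to `(fontainePst F p hp).𝔅 = B_dR(F)` (`HT_τ(1) = {0}` and the accepted shift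
`fontainePst_labelledHodgeTateWeights_of_cyclotomic_zpow`, `HT_τ(ρ ⊗ χ_p^m) = HT_τ(ρ) - m`).  This is the
conclusion of the accepted `fontainePst_cyclotomicPowersLabelledWeights` WITHOUT its hypothesis
`FontaineDatumExists`: Fontaine's `D_dR(ℚ_p(m)) = F · t^{-m}`.
[cite: FontaineAsterisque223III, Exp. II §1.5.5 and Exp. III §1.5] [cite: BarnetlambEtAl2014, Introduction (Notation)]
[cite: BuzzardGeeLMS2014, §2.4] -/
theorem cyclotomicPowersLabelledWeights_fontainePst_of_bdR (hp : valuation F p < 1) :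
    (fontainePst F p hp).CyclotomicPowersLabelledWeights := by
  rw [PstWeilDeligneData.cyclotomicPowersLabelledWeights_iff]
  intro m χ hχ
  letI := (fontainePst F p hp).algebra
  intro τ
  have hρ' : ∀ (σ : absoluteGaloisGroup F) (v : Fin 1 → PadicAlgCl p),
      FramedRep.toContinuousRep χ σ v =
        ((((GaloisRep.cyclotomicCharacter F p σ : ℤ_[p]ˣ) : ℤ_[p]) : ℚ_[p]) ^ m) •
          FramedRep.toContinuousRep (1 : FramedRep (absoluteGaloisGroup F) (PadicAlgCl p) 1) σ v := by
    intro σ v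
    rw [toContinuousRep_one_apply, FramedRep.toContinuousRep_apply_apply]
    funext i
    have hi : i = 0 := Subsingleton.elim i 0
    subst hi
    simp only [Matrix.mulVec, dotProduct, Fin.sum_univ_one, Pi.smul_apply, Algebra.smul_def, hχ σ]
  have h := fontainePst_labelledHodgeTateWeights_of_cyclotomic_zpow hp
    (FramedRep.toContinuousRep (1 : FramedRep (absoluteGaloisGroup F) (PadicAlgCl p) 1))
    (FramedRep.toContinuousRep χ) m hρ' τ.toRingHom
  rw [fontainePst_labelledHodgeTateWeights_one (n := 1) hp τ] at h
  change (fontainePst F p hp).𝔅.labelledHodgeTateWeights (FramedRep.toContinuousRep χ) τ.toRingHom = {-m}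
  rw [h]
  simp

end Local

/-! ### The summit's datum at `v ∣ p` and the route child `PinnedCyclotomicPowersWeights` -/

section NumberField

variable {K : Type} [Field K] [NumberField K]

/-- **`HT_τ(ε^m) = {-m}` for the summit's datum at `v ∣ p` — unconditionally** (clause (F11) for
`fontainePstAdicCompletion v p hv`; the conclusion of the accepted
`cyclotomicPowersLabelledWeights_fontainePstAdicCompletion` without `FontaineDatumExists`).
[cite: FontaineAsterisque223III, Exp. III §1.5] [cite: BarnetlambEtAl2014, Introduction (Notation)] -/
theorem cyclotomicPowersLabelledWeights_fontainePstAdicCompletion_of_bdR (v : HeightOneSpectrum (𝓞 K))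
    (p : ℕ) [Fact p.Prime] (hv : ((p : ℕ) : 𝓞 K) ∈ v.asIdeal) :
    (fontainePstAdicCompletion v p hv).CyclotomicPowersLabelledWeights := by
  haveI := LocalField.charZero_adicCompletion v
  exact cyclotomicPowersLabelledWeights_fontainePst_of_bdR _

/-- **The route child `PinnedCyclotomicPowersWeights` of `Langlands/WachComponentCensus`, verbatim —
unconditionally** (clause (F11) of the pin at every place `v ∣ p` of every number field; the
conclusion of the accepted `FontaineDatumExists.pinnedCyclotomicPowersWeights` without the named fact).
[cite: FontaineAsterisque223III, Exp. III §1.5] [cite: BarnetlambEtAl2014, Introduction (Notation)]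
[cite: BuzzardGeeLMS2014, §2.4] -/
theorem pinnedCyclotomicPowersWeights_of_bdR :
    ∀ (F : Type) [Field F] [NumberField F] (p : ℕ) [Fact p.Prime]
      (v : HeightOneSpectrum (𝓞 F)) (hv : ((p : ℕ) : 𝓞 F) ∈ v.asIdeal),
      (fontainePstAdicCompletion v p hv).CyclotomicPowersLabelledWeights :=
  fun _ _ _ p _ v hv => cyclotomicPowersLabelledWeights_fontainePstAdicCompletion_of_bdR v p hv

end NumberField

end Literature.NumberTheory.PAdicHodge

end
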